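import Summits.QuantumFields.QCD.Theorems.NestedDissectionSeaRobustYangMillsLocalAC
import Summits.QuantumFields.QCD.Theses.HeavyThresholdYMBridge
import Summits.QuantumFields.QCD.Theorems.RobustYangMills.Negative.NoSmallFalse
import Summits.QuantumFields.QCD.Theorems.RobustYangMills.Negative.MixtureWitness

/-!
# Line `local-ac-open-certificate` for the crux `RobustYangMills` (stmt-QuantumFields-13897) —
# the ultraviolet regime `UVRider` (statement of the OPEN stub `stub_uvRider`) and its size

Crux: `Summit.QuantumFields.QCD.Theses.NestedDissectionSea.RobustYangMills` (shared verbatim with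
`HeavyThresholdYMBridge` / `AdaptiveBlockFermions`), item stmt-QuantumFields-13897; checked skeleton
`Cruxes/RobustYangMills/Lines/local_ac_open_certificate.lean` (reshape r4′), §4 `Legs`. Companion
module `NestedDissectionSeaRobustYangMillsLocalAC` (§0: `AdmAt`, `Concl`, `ClauseCluster`, `budget`,
`Explicit`, …; same namespace).

The line splits the crux by block scale `ℓ₀ ≷ c₁/Λ'`: the infrared regime `c₁ ≤ Λ'ℓ₀` is the line's
mechanism (toolkit + engine + certificate ⇒ uniform clustering of the cone); the ultraviolet regime
`Λ'ℓ₀ < c` is FOREIGN to it and is registered as the open stub `stub_uvRider : UVRider`, consumed by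
the composition `RobustYangMills_of` as `hG c₁ hc₁`. This module carries, verbatim from the skeleton,

* `UVRider` — the crux restricted to block scales `ℓ₀ < c/Λ'`, for every `c > 0`, with its own
  constants `(η₄, κ₄)`;

and places it, kernel-checked, between the crux and the route item stmt-QuantumFields-8796
(`HeavyThresholdYMBridge.YMLatticeGapAlongAFSequences`, β-universality of the `SU(3)` lattice gap):

* `uvRider_of_explicit`, `uvRider_of_robustYangMills`, `uvRider_of_robustYangMills_primary` —
  the crux (named form / `NestedDissectionSea` copy / primary `HeavyThresholdYMBridge` copy) implies
  `UVRider` (take `η₄ := η₀`, `κ₄ := κ` for every `c`; definitional unfolding);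
* `admAt_zero` — the zero family `W ≡ 0` is admissible at every level `k` with `0 ≤ β'_k`, for every
  `κ` and every `η ≥ 0` ((h1) `total 0 = 0`; (h2) odd-torus reflection positivity of Wilson's
  measure, `Negative.isReflectionPositive_zero_all`; (h3) `normLE_zero`; (h4) vacuous, `act 0 = 0`);
* `uvRider_imp_ymLatticeGapAlongAFSequences` — `UVRider` implies stmt-8796: at `c := 1`, block scale
  `ℓ₀ := 1/(2Λ')` and `W ≡ 0` (admissible eventually, a.f. sequences being eventually non-negative,
  `Negative.eventually_nonneg_of_af`), clause (iii′) of `Concl` is the uniform lattice gap of the PURE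
  Wilson theory (`QuasiLocalGaugePerturbation.connectedCorr_zero`).

So `stub_uvRider` is at least Yang–Mills-hard (it contains the `W ≡ 0` lattice-gap core along every
a.f. sequence) and at most the crux; it is not proved here.
-/

set_option autoImplicit false

noncomputable section

namespace Summit.QuantumFields.QCD.Cruxes.RobustYangMills.LocalAcOpenCertificate

open scoped BigOperators Topology ENNReal
open Filter MeasureTheory
open Literature.MathematicalPhysics.QuantumLattice Literature.MathematicalPhysics.AQFT
  Literature.MathematicalPhysics.QuantumFieldTheory

/-! ## §4 (legs) The ultraviolet regime -/

/-- **The ultraviolet regime** (statement of `stub_uvRider`; FOREIGN to this line — it is the crux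
restricted to block scales `ℓ₀ < c/Λ'`, for every `c > 0`, i.e. the territory of the rider
(card soft-absorption-balaban-cone: soft conditioning into Bałaban's analytic format and the RG-level
item #2′; triage r1-3 scope line (3)): the `(ℓ/ℓ₀)⁴` wall is real — below `c₁/Λ'` cone members shift
the infrared scale and no bounded-density argument reaches the certificate scale). Stated with its
own `(η₄, κ₄)`; the composition reconciles the constants by monotonicity. It inherits the (iv) flag. -/
def UVRider : Prop :=
  ∀ c : ℝ, 0 < c → ∃ η₄ : ℝ, 0 < η₄ ∧ ∃ κ₄ : ℝ, 0 ≤ κ₄ ∧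
    ∀ (a : ℕ → ℝ) (L : ℕ → ℕ) (ha : ∀ k, 0 < a k) (ha₀ : Tendsto a atTop (𝓝 0))
      (haL : Tendsto (fun k => a k * L k) atTop atTop) (β' : ℕ → ℝ) (Λ' : ℝ), 0 < Λ' →
      Tendsto (fun k => β' k - afBeta 0 Λ' (a k)) atTop (𝓝 0) →
    ∀ ℓ₀ : ℝ, 0 < ℓ₀ → Λ' * ℓ₀ < c →
    ∀ W : Family a ℓ₀, (∀ᶠ k in atTop, AdmAt κ₄ (budget η₄ Λ' ℓ₀) a L β' ℓ₀ W k) →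
      Concl κ₄ (budget η₄ Λ' ℓ₀) a L ha ha₀ haL β' ℓ₀ W

/-! ## Size from above: the crux implies the ultraviolet regime -/

/-- The named form of the crux at `(η₀, κ)` gives `UVRider` with `η₄ := η₀`, `κ₄ := κ` for every
`c > 0` (the restriction `Λ'ℓ₀ < c` is simply dropped). -/
theorem uvRider_of_explicit {η₀ κ : ℝ} (hη₀ : 0 < η₀) (hκ : 0 ≤ κ) (h : Explicit η₀ κ) :
    UVRider := fun _ _ =>
  ⟨η₀, hη₀, κ, hκ, fun a L ha ha₀ haL β' Λ' hΛ' hβ' ℓ₀ hℓ₀ _ W hW =>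
    h a L ha ha₀ haL β' Λ' hΛ' hβ' ℓ₀ hℓ₀ W hW⟩

/-- **The crux implies `UVRider`** (`NestedDissectionSea` copy of stmt-QuantumFields-13897): given
the crux's `(η₀, κ)`, for any `c` take `η₄ := η₀`, `κ₄ := κ`; the crux's hypothesis at
`(a, L, β', Λ', ℓ₀, W)` is literally `∀ᶠ k, AdmAt κ (budget η₀ Λ' ℓ₀) a L β' ℓ₀ W k` and its
conclusion is literally `Concl κ (budget η₀ Λ' ℓ₀) a L ha ha₀ haL β' ℓ₀ W` (definitional unfolding,
`robustYangMills_of_explicit` run backwards). -/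
theorem uvRider_of_robustYangMills
    (hR : Summit.QuantumFields.QCD.Theses.NestedDissectionSea.RobustYangMills) : UVRider := by
  obtain ⟨η₀, hη₀, κ, hκ, h⟩ := hR
  refine uvRider_of_explicit hη₀ hκ ?_
  intro a L ha ha₀ haL β' Λ' hΛ' hβ' ℓ₀ hℓ₀ W hW
  exact h a L ha ha₀ haL β' Λ' hΛ' hβ' ℓ₀ hℓ₀ W hW

/-- The same for the PRIMARY copy `HeavyThresholdYMBridge.RobustYangMills` of the shared crux (the
route copies are verbatim, hence definitionally equal). -/
theorem uvRider_of_robustYangMills_primary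
    (hR : Summit.QuantumFields.QCD.Theses.HeavyThresholdYMBridge.RobustYangMills) : UVRider :=
  uvRider_of_robustYangMills hR

/-! ## Size from below: the ultraviolet regime contains the pure-Wilson lattice gap (stmt-8796) -/

/-- **`W ≡ 0` is admissible** at level `k` whenever `0 ≤ β'_k`, for every decay rate `κ`, every
budget `η ≥ 0`, every scaling datum and every block scale: (h1) the total of `0` vanishes
identically; (h2) odd-torus reflection positivity of Wilson's measure in D1's format
(`Negative.isReflectionPositive_zero_all`); (h3) `‖0‖ = 0 ≤ η` (`normLE_zero`); (h4) vacuous, all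
activities of `0` vanish. -/
theorem admAt_zero {κ η : ℝ} (hη : 0 ≤ η) (a : ℕ → ℝ) (L : ℕ → ℕ) {β' : ℕ → ℝ} (ℓ₀ : ℝ)
    {k : ℕ} (hk : 0 ≤ β' k) : AdmAt κ η a L β' ℓ₀ (fun _ _ => 0) k := by
  intro S _
  refine ⟨fun v U => by simp, fun U => by simp, fun π U => by simp,
    Summit.QuantumFields.QCD.Theorems.RobustYangMills.Negative.isReflectionPositive_zero_all ρ₃
      (continuous_fundamentalRep _) S _ hk,
    QuasiLocalGaugePerturbation.normLE_zero hη, ?_⟩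
  rintro X - ⟨U, hU⟩
  simp at hU

/-- Hence along a.f. data (`β'_k - afBeta 0 Λ' a_k → 0`, so `β'_k ≥ 0` eventually,
`Negative.eventually_nonneg_of_af`) the zero family is admissible eventually in `k`, at every
`(κ, η ≥ 0, ℓ₀)`. -/
theorem eventually_admAt_zero {κ η : ℝ} (hη : 0 ≤ η) {a : ℕ → ℝ} (L : ℕ → ℕ) (ha : ∀ k, 0 < a k)
    (ha₀ : Tendsto a atTop (𝓝 0)) {β' : ℕ → ℝ} {Λ' : ℝ} (hΛ' : 0 < Λ')
    (hβ' : Tendsto (fun k => β' k - afBeta 0 Λ' (a k)) atTop (𝓝 0)) (ℓ₀ : ℝ) :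
    ∀ᶠ k in atTop, AdmAt κ η a L β' ℓ₀ (fun _ _ => 0) k :=
  (Summit.QuantumFields.QCD.Theorems.RobustYangMills.Negative.eventually_nonneg_of_af ha ha₀ hΛ'
    hβ').mono fun _ hk => admAt_zero hη a L ℓ₀ hk

/-- Clause (iii′) for the zero family is the uniform lattice gap of the PURE `SU(3)` Wilson theory
(`QuasiLocalGaugePerturbation.connectedCorr_zero`). -/
theorem clauseCluster_zero_iff {a : ℕ → ℝ} {L : ℕ → ℕ} {β' : ℕ → ℝ} {ℓ₀ Δ : ℝ} :
    ClauseCluster a L β' ℓ₀ (fun _ _ => 0) Δ ↔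
      ∀ A B : YMSpecies SU3, ∃ C : ℝ, ∀ᶠ k in atTop, ∀ S : ℕ, L k ≤ S → ∀ n : ℕ, n ≤ S →
        |latticeConnectedCorr ρ₃ (β' k) (2 * S + 1) A.F B.F n| ≤ C * Real.exp (-(Δ * (a k * n))) := by
  simp only [ClauseCluster, QuasiLocalGaugePerturbation.connectedCorr_zero]

/-- **`UVRider` implies stmt-QuantumFields-8796** (`YMLatticeGapAlongAFSequences`, the lattice gap of
`SU(3)` Wilson Yang–Mills along EVERY a.f. coupling sequence, uniformly in the volume): at `c := 1`
the rider provides `(η₄, κ₄)`; given a.f. data `(a, L, β', Λ')` choose the block scale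
`ℓ₀ := 1/(2Λ')` (`Λ'ℓ₀ = 1/2 < 1`) and the zero family `W ≡ 0`, admissible eventually in `k`
(`eventually_admAt_zero`, budget `≥ 0`); clause (iii′) of the rider's conclusion at rate `Δ` is the
pure-Wilson lattice gap (`clauseCluster_zero_iff`). So the open stub `stub_uvRider` is at least as
strong as the `W ≡ 0` Yang–Mills lattice-gap core. (Registered on the crux item as the CLOSED size sub-goal
of `stub_uvRider`; one-line header = registered signature.) -/
theorem uvRider_imp_ymLatticeGapAlongAFSequences : UVRider → Summit.QuantumFields.QCD.Theses.HeavyThresholdYMBridge.YMLatticeGapAlongAFSequences := by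
  intro hU a L ha ha₀ haL β' hβ
  obtain ⟨Λ', hΛ', hβ'⟩ := hβ
  obtain ⟨η₄, hη₄, κ₄, _, h⟩ := hU 1 one_pos
  have hℓ₀ : 0 < 1 / (2 * Λ') := by positivity
  have hlt : Λ' * (1 / (2 * Λ')) < 1 := by
    rw [mul_one_div, div_lt_one (by positivity)]
    linarith
  have hη : 0 ≤ budget η₄ Λ' (1 / (2 * Λ')) :=
    div_nonneg hη₄.le (le_trans zero_le_one (le_max_left _ _))
  obtain ⟨φ, -, c, m, T, Δ, hΔ, -, -, -, -, hgapL, -⟩ :=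
    h a L ha ha₀ haL β' Λ' hΛ' hβ' _ hℓ₀ hlt (fun _ _ => 0)
      (eventually_admAt_zero hη L ha ha₀ hΛ' hβ' _)
  exact ⟨Δ, hΔ, clauseCluster_zero_iff.1 hgapL⟩

/-- **Corollary: the crux implies stmt-QuantumFields-8796** through the ultraviolet regime alone
(primary copy `HeavyThresholdYMBridge.RobustYangMills`). -/
theorem robustYangMills_imp_ymLatticeGapAlongAFSequences
    (hR : Summit.QuantumFields.QCD.Theses.HeavyThresholdYMBridge.RobustYangMills) :
    Summit.QuantumFields.QCD.Theses.HeavyThresholdYMBridge.YMLatticeGapAlongAFSequences :=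
  uvRider_imp_ymLatticeGapAlongAFSequences (uvRider_of_robustYangMills_primary hR)

end Summit.QuantumFields.QCD.Cruxes.RobustYangMills.LocalAcOpenCertificate

end
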